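import Literature.Topology.FourManifolds.LatticeFormsSpecialOrthogonalEichlerGeneration
import HarnessLib

/-!
# Unimodular transvections are products of two reflections: `t(e,a) = σ_a σ_{a+εe}` over `ℤ`, `E(L) ⊆ ⟨σ_a σ_b⟩`, and for
# `L = 3U`: `O⁺(3U)` is generated by the `(−2)`-reflections, `SO⁺(3U) = ⟨σ_a σ_b⟩`
# (Gritsenko–Hulek–Sankaran, *J. Algebra* 322 (2009) §3.1 (t6), Thm. 1.1 (Kneser) — the case `L = 3U`)

Trunk T-4MAN vocabulary. Sequel of `LatticeFormsSpecialOrthogonalEichlerGeneration.lean` (row g49-#7: `SO⁺(3U) = E(3U)`),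
`LatticeFormsEichlerReflections.lean` (`σ_r = normTwoReflection(Equiv)`), `LatticeFormsStableSpecialOrthogonalWords.lean`
(words in `(−2)`-reflections lie in `Õ⁺`), `LatticeFormsTransvectionsStableSpecialOrthogonal.lean` ((t6) over a field). Written
for lane `lit-hodgefound` (Track 2 foundations; prover seat `lit-hodgefound-p18`, gen 49, row g49-#8). THEOREMS ONLY — no
definition, no named fact, no instance, no notation.

## Source, verbatim (held text `paper:arxiv-0810.1614`)

* §3.1 p. 6: "(t6) `t(e,a) = σ_a σ_{a+½(a,a)e}` if `(a,a) ≠ 0`. […] From equation (t6) we have that `t(e,a) ∈ SO⁺(L ⊗ ℚ)`."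
* §1 p. 3: "**Theorem 1.1** ([Kn1]) Let `L` be an even integral lattice of Witt index `≥ 2` over `ℝ`. We assume that `L`
  represents `−2` and that `rank₃(L) ≥ 5` and `rank₂(L) ≥ 6`. Then `O'(L)` is generated by the products of reflections `σ_aσ_b`
  where `a, b ∈ L` and `a² = b² = −2`." and Cor. 1.2 "`O'(L) = S̃O⁺(L)`"; §3.3 p. 7: "(16) `S̃O⁺(L) = O'(L) = E(L) = E_U(L₁)`";
  §4 p. 8: "`Õ⁺(L) = ⟨S̃O⁺(L), σ_{e−f}⟩`".

## Contents (all proved) and reading notes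

* §1 **(t6) over `ℤ` for `(a,a) = ±2`**: `E(e,a,ε) = σ_a ∘ σ_{a+εe}` for `a ⊥ e`, `e` isotropic, `(a,a) = 2ε`, `ε = ±1` — both
  `a` and `a + εe` have norm `2ε` (`eichlerTransvection_eq_normTwoReflection_comp`); so such a transvection is a word in the
  `(2ε)`-reflections (`isWordIn_reflections_eichlerTransvection_of_apply_self`).
* §2 **`E_U(L₁) ⊆ ⟨σ_r : r² = 2ε⟩`** for a symmetric even `(W,B)` with two orthogonal hyperbolic pairs and ONE vector `r ⊥ U, U₁`
  of norm `2ε` (a root of `L₀`, or `e₂ + εf₂` from a third plane): by (t3), `t(e,f₁) = t(e,f₁+r) t(e,−r)`,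
  `t(e,w) = t(e, w + f₁ + s e₁) t(e,−f₁) t(e,−s e₁)` with `s = ε − w²/2`, and `t(e,a) = t(e,αf₁) t(e,βe₁) t(e,w)` — every letter and
  every admissible word is a word in `(2ε)`-reflections (`isWordIn_reflections_evalEquiv`). This is the easy inclusion
  `E(L) ⊆ ⟨σ_aσ_b⟩` behind (16); each transvection used is a product of an EVEN number of reflections.
* §3 **`L = 3U`** (with g49-#7 `SO⁺(3U) = E(3U)` and g49-#4): every `φ ∈ SO⁺(U ⊕ U ⊕ U)` is a word in `(−2)`-reflections and
  in `(+2)`-reflections (`isWordIn_reflections_of_isOrientationPreserving_of_det_eq_one_threeU`), and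
  **`O⁺(3U) = ⟨σ_r : r² = −2⟩`** exactly (`isWordIn_negTwoReflections_iff_isOrientationPreserving_threeU`: words in
  `(−2)`-reflections lie in `O⁺`, and `O⁺ = SO⁺ ∪ SO⁺·σ_{e−f}`) — Kneser's Theorem 1.1 / "`Õ⁺ = ⟨S̃O⁺, σ_{e−f}⟩`" for this
  lattice, with no `p`-rank bookkeeping.
-/

noncomputable section

open Module
open LinearMap (BilinForm)
open LinearMap.BilinForm
open LinearMap.BilinForm (IsometryEquiv)
open Literature.LinearAlgebra.QuadraticForm

namespace Literature.Topology.FourManifolds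

variable {W : Type*} [AddCommGroup W] {B : BilinForm ℤ W}

/-! ### §1 (t6) over `ℤ`: `t(e,a) = σ_a σ_{a+εe}` for `(a,a) = 2ε` -/

section T6

variable {e a : W} {ε : ℤ}

/-- `(a + εe)² = 2ε` for `a ⊥ e`, `e` isotropic, `(a,a) = 2ε`. [cite: GritsenkoHulekSankaran2009, §3.1 (t6)] -/
theorem apply_add_smul_isotropic_self (he : B e e = 0) (hea : B e a = 0) (hae : B a e = 0) (haa : B a a = ε + ε) :
    B (a + ε • e) (a + ε • e) = ε + ε := by
  simp only [map_add, map_smul, LinearMap.add_apply, LinearMap.smul_apply, smul_eq_mul, he, hea, hae, haa]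
  ring

/-- **(t6) over `ℤ`: `t(e,a) = σ_a σ_{a + ½(a,a)e}` when `(a,a) = ±2`** — `E(e, a, ε) = σ_a ∘ σ_{a+εe}` as linear maps
(`B` symmetric, `a ⊥ e`, `(a,a) = 2ε`, `ε² = 1`; as an identity of the defining formulas it does not even use `(e,e) = 0`;
the field version is `eichlerTransvection_eq_reflection_mul_reflection`). [cite: GritsenkoHulekSankaran2009, §3.1 (t6)] -/
theorem eichlerTransvection_eq_normTwoReflection_comp (hB : B.IsSymm) (hea : B e a = 0) (haa : B a a = ε + ε)
    (hε : ε * ε = 1) :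
    B.eichlerTransvection e a ε = B.normTwoReflection a ε ∘ₗ B.normTwoReflection (a + ε • e) ε := by
  have hae : B a e = 0 := by rw [hB.eq, hea]
  refine LinearMap.ext fun v ↦ ?_
  rw [LinearMap.comp_apply, LinearMap.BilinForm.normTwoReflection_apply, LinearMap.BilinForm.normTwoReflection_apply]
  simp only [LinearMap.BilinForm.eichlerTransvection_apply, map_add, map_sub, map_smul, LinearMap.add_apply,
    LinearMap.smul_apply, smul_eq_mul, hae, haa]
  obtain rfl | rfl := Int.eq_one_or_neg_one_of_mul_eq_one hε <;> module

/-- **A transvection `t(e,a)` with `(a,a) = 2ε = ±2` is a word (of length two) in the reflections in `(2ε)`-vectors.**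
[cite: GritsenkoHulekSankaran2009, §3.1 (t6)] -/
theorem isWordIn_reflections_eichlerTransvection_of_apply_self (hB : B.IsSymm) (he : B e e = 0) (hea : B e a = 0)
    (haa : B a a = ε + ε) (hε : ε * ε = 1) :
    IsWordIn {ψ : B.IsometryEquiv B | ∃ (r : W) (hr : B r r = ε + ε), ψ = normTwoReflectionEquiv hB r ε hr hε}
      (LinearMap.BilinForm.IsometryEquiv.eichlerTransvection B hB e a ε he hea haa) := by
  have hae : B a e = 0 := by rw [hB.eq, hea]
  have h2 := apply_add_smul_isotropic_self he hea hae haa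
  have key := eichlerTransvection_eq_normTwoReflection_comp hB hea haa hε
  refine ((IsWordIn.of_mem (S := {ψ : B.IsometryEquiv B | ∃ (r : W) (hr : B r r = ε + ε),
      ψ = normTwoReflectionEquiv hB r ε hr hε}) ⟨a + ε • e, h2, rfl⟩).trans
    (IsWordIn.of_mem ⟨a, haa, rfl⟩)).congr fun v ↦ ?_
  rw [LinearMap.BilinForm.IsometryEquiv.trans_apply, normTwoReflectionEquiv_apply, normTwoReflectionEquiv_apply,
    ← LinearMap.BilinForm.normTwoReflection_apply, ← LinearMap.BilinForm.normTwoReflection_apply,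
    LinearMap.BilinForm.IsometryEquiv.eichlerTransvection_apply, key, LinearMap.comp_apply]

end T6

/-! ### §2 `E_U(L₁)` is generated by pairs of `(2ε)`-reflections, given one `(2ε)`-vector `r ⊥ U ⊕ U₁` -/

section Words

variable {x y x₁ y₁ r : W} {ε : ℤ}

/-- **`t(e,f₁) = t(e, f₁ + r) t(e, −r)`**, so `t(e,f₁) = E(y,x₁,0)` is a word in `(2ε)`-reflections (`r ⊥ U, U₁` of norm
`2ε`; `(f₁ + r)² = (−r)² = 2ε`). [cite: GritsenkoHulekSankaran2009, §3.1 (t3), (t6)] -/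
theorem isWordIn_reflections_eichlerTransvection_y_x₁ (h : TwoHyperbolicPairs B x y x₁ y₁) (hε : ε * ε = 1)
    (hyr : B y r = 0) (hx₁r : B x₁ r = 0) (hrr : B r r = ε + ε) (hx₁' : B x₁ x₁ = 0 + 0) :
    IsWordIn {ψ : B.IsometryEquiv B | ∃ (r : W) (hr : B r r = ε + ε), ψ = normTwoReflectionEquiv h.isSymm r ε hr hε}
      (LinearMap.BilinForm.IsometryEquiv.eichlerTransvection B h.isSymm y x₁ 0 h.yy h.yx₁ hx₁') := by
  have hB := h.isSymm
  have hrx₁ : B r x₁ = 0 := by rw [hB.eq, hx₁r]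
  have hy₁' : B y (x₁ + r) = 0 := by rw [map_add, h.yx₁, hyr, add_zero]
  have hn₁ : B (x₁ + r) (x₁ + r) = ε + ε := by
    simp only [map_add, LinearMap.add_apply, h.x₁x₁, hx₁r, hrx₁, hrr]; ring
  have hy₂ : B y (-r) = 0 := by rw [map_neg, hyr, neg_zero]
  have hn₂ : B (-r) (-r) = ε + ε := by simp only [map_neg, LinearMap.neg_apply, neg_neg, hrr]
  have w₁ := isWordIn_reflections_eichlerTransvection_of_apply_self hB h.yy hy₁' hn₁ hε
  have w₂ := isWordIn_reflections_eichlerTransvection_of_apply_self hB h.yy hy₂ hn₂ hε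
  have comp : B.eichlerTransvection y (x₁ + r) ε ∘ₗ B.eichlerTransvection y (-r) ε = B.eichlerTransvection y x₁ 0 := by
    rw [LinearMap.BilinForm.eichlerTransvection_comp B hB h.yy hy₁' hy₂]
    have hp : ε + ε + B (x₁ + r) (-r) = 0 := by
      rw [map_add, LinearMap.add_apply, map_neg, map_neg, hx₁r, hrr]; ring
    rw [hp, add_neg_cancel_right]
  refine (w₂.trans w₁).congr fun v ↦ ?_
  rw [LinearMap.BilinForm.IsometryEquiv.trans_apply, LinearMap.BilinForm.IsometryEquiv.eichlerTransvection_apply,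
    LinearMap.BilinForm.IsometryEquiv.eichlerTransvection_apply, LinearMap.BilinForm.IsometryEquiv.eichlerTransvection_apply,
    ← LinearMap.comp_apply, comp]

/-- **Every power `t(e, c f₁)` is a word in `(2ε)`-reflections.** [cite: GritsenkoHulekSankaran2009, §3.1 (t3), (t6)] -/
theorem isWordIn_reflections_eichlerTransvection_y_smul_x₁ (h : TwoHyperbolicPairs B x y x₁ y₁) (hε : ε * ε = 1)
    (hyr : B y r = 0) (hx₁r : B x₁ r = 0) (hrr : B r r = ε + ε) (c : ℤ) (hyc : B y (c • x₁) = 0)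
    (hcc : B (c • x₁) (c • x₁) = 0 + 0) :
    IsWordIn {ψ : B.IsometryEquiv B | ∃ (r : W) (hr : B r r = ε + ε), ψ = normTwoReflectionEquiv h.isSymm r ε hr hε}
      (LinearMap.BilinForm.IsometryEquiv.eichlerTransvection B h.isSymm y (c • x₁) 0 h.yy hyc hcc) := by
  have hx₁' : B x₁ x₁ = 0 + 0 := by rw [h.x₁x₁, add_zero]
  refine (isWordIn_eichlerTransvection_zsmul h.isSymm h.yy h.yx₁ hx₁' c hyc hcc).bind fun s hs ↦ ?_
  rw [Set.mem_singleton_iff.1 hs]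
  exact isWordIn_reflections_eichlerTransvection_y_x₁ h hε hyr hx₁r hrr hx₁'

/-- **`t(e, w) = t(e, w + f₁ + s e₁) t(e, −f₁) t(e, −s e₁)` with `s = ε − w²/2`**, so `t(e,w)` is a word in
`(2ε)`-reflections for every `w ∈ L₀ = (U ⊕ U₁)^⊥` with `w² = 2m`. [cite: GritsenkoHulekSankaran2009, §3.1 (t3), (t6)] -/
theorem isWordIn_reflections_eichlerTransvection_y_of_ortho (h : TwoHyperbolicPairs B x y x₁ y₁) (hε : ε * ε = 1)
    (hyr : B y r = 0) (hx₁r : B x₁ r = 0) (hy₁r : B y₁ r = 0) (hrr : B r r = ε + ε) {w : W} {m : ℤ} (hyw : B y w = 0)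
    (hx₁w : B x₁ w = 0) (hy₁w : B y₁ w = 0) (hww : B w w = m + m) :
    IsWordIn {ψ : B.IsometryEquiv B | ∃ (r : W) (hr : B r r = ε + ε), ψ = normTwoReflectionEquiv h.isSymm r ε hr hε}
      (LinearMap.BilinForm.IsometryEquiv.eichlerTransvection B h.isSymm y w m h.yy hyw hww) := by
  have hB := h.isSymm
  have hwx₁ : B w x₁ = 0 := by rw [hB.eq, hx₁w]
  have hwy₁ : B w y₁ = 0 := by rw [hB.eq, hy₁w]
  set s : ℤ := ε - m with hs
  -- the three factors
  have hy₁' : B y (w + x₁ + s • y₁) = 0 := by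
    rw [map_add, map_add, map_smul, hyw, h.yx₁, h.yy₁, smul_zero, add_zero, add_zero]
  have hn₁ : B (w + x₁ + s • y₁) (w + x₁ + s • y₁) = ε + ε := by
    simp only [map_add, map_smul, LinearMap.add_apply, LinearMap.smul_apply, smul_eq_mul, hww, hwx₁, hwy₁, hx₁w, hy₁w,
      h.x₁x₁, h.x₁y₁, h.y₁x₁, h.y₁y₁, hs]
    ring
  have hF₁ := isWordIn_reflections_eichlerTransvection_of_apply_self hB h.yy hy₁' hn₁ hε
  have hy₂ : B y (-x₁) = 0 := by rw [map_neg, h.yx₁, neg_zero]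
  have hn₂ : B (-x₁) (-x₁) = 0 + 0 := by simp [h.x₁x₁]
  have hF₂ : IsWordIn {ψ : B.IsometryEquiv B | ∃ (r : W) (hr : B r r = ε + ε), ψ = normTwoReflectionEquiv hB r ε hr hε}
      (LinearMap.BilinForm.IsometryEquiv.eichlerTransvection B hB y (-x₁) 0 h.yy hy₂ hn₂) := by
    have := isWordIn_reflections_eichlerTransvection_y_smul_x₁ h hε hyr hx₁r hrr (-1) (by rw [neg_one_smul]; exact hy₂)
      (by rw [neg_one_smul]; exact hn₂)
    refine this.congr fun v ↦ ?_
    rw [LinearMap.BilinForm.IsometryEquiv.eichlerTransvection_apply, LinearMap.BilinForm.IsometryEquiv.eichlerTransvection_apply,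
      neg_one_smul]
  have hy₃ : B y (-(s • y₁)) = 0 := by rw [map_neg, map_smul, h.yy₁, smul_zero, neg_zero]
  have hn₃ : B (-(s • y₁)) (-(s • y₁)) = 0 + 0 := by simp [h.y₁y₁]
  have hF₃ : IsWordIn {ψ : B.IsometryEquiv B | ∃ (r : W) (hr : B r r = ε + ε), ψ = normTwoReflectionEquiv hB r ε hr hε}
      (LinearMap.BilinForm.IsometryEquiv.eichlerTransvection B hB y (-(s • y₁)) 0 h.yy hy₃ hn₃) := by
    have := isWordIn_reflections_eichlerTransvection_y_smul_x₁ h.symm_right hε hyr hy₁r hrr (-s)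
      (by rw [neg_smul]; exact hy₃) (by rw [neg_smul]; exact hn₃)
    refine this.congr fun v ↦ ?_
    rw [LinearMap.BilinForm.IsometryEquiv.eichlerTransvection_apply, LinearMap.BilinForm.IsometryEquiv.eichlerTransvection_apply,
      neg_smul]
  -- (t3) twice
  have comp : B.eichlerTransvection y (w + x₁ + s • y₁) ε ∘ₗ (B.eichlerTransvection y (-x₁) 0 ∘ₗ
      B.eichlerTransvection y (-(s • y₁)) 0) = B.eichlerTransvection y w m := by
    rw [LinearMap.BilinForm.eichlerTransvection_comp B hB h.yy hy₂ hy₃,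
      LinearMap.BilinForm.eichlerTransvection_comp B hB h.yy hy₁' (by rw [map_add, hy₂, hy₃, add_zero])]
    have hv : w + x₁ + s • y₁ + (-x₁ + -(s • y₁)) = w := by module
    have hp : ε + (0 + 0 + B (-x₁) (-(s • y₁))) + B (w + x₁ + s • y₁) (-x₁ + -(s • y₁)) = m := by
      simp only [map_add, map_neg, map_smul, LinearMap.add_apply, LinearMap.neg_apply, LinearMap.smul_apply, smul_eq_mul,
        hwx₁, hwy₁, h.x₁x₁, h.x₁y₁, h.y₁x₁, h.y₁y₁, hs]
      ring
    rw [hv, hp]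
  refine ((hF₃.trans hF₂).trans hF₁).congr fun v ↦ ?_
  rw [LinearMap.BilinForm.IsometryEquiv.trans_apply, LinearMap.BilinForm.IsometryEquiv.trans_apply,
    LinearMap.BilinForm.IsometryEquiv.eichlerTransvection_apply, LinearMap.BilinForm.IsometryEquiv.eichlerTransvection_apply,
    LinearMap.BilinForm.IsometryEquiv.eichlerTransvection_apply, LinearMap.BilinForm.IsometryEquiv.eichlerTransvection_apply,
    ← comp, LinearMap.comp_apply, LinearMap.comp_apply]

/-- **Every admissible letter `E(y, a, q)` is a word in `(2ε)`-reflections** (`a = αf₁ + βe₁ + w`, (t3)).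
[cite: GritsenkoHulekSankaran2009, §3.1 (t3), (t6) and §3.3 (16) ("E(L) = O'(L)")] -/
theorem isWordIn_reflections_toIsometryEquiv_atY (h : TwoHyperbolicPairs B x y x₁ y₁) (hε : ε * ε = 1)
    (hyr : B y r = 0) (hx₁r : B x₁ r = 0) (hy₁r : B y₁ r = 0) (hrr : B r r = ε + ε) (a : W) (q : ℤ)
    (hg : (UGen.atY a q).IsAdmissible B x y) :
    IsWordIn {ψ : B.IsometryEquiv B | ∃ (r : W) (hr : B r r = ε + ε), ψ = normTwoReflectionEquiv h.isSymm r ε hr hε}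
      (UGen.toIsometryEquiv h.isSymm h.xx h.yy (UGen.atY a q) hg) := by
  have hB := h.isSymm
  obtain ⟨-, hya, hq⟩ := hg
  set α : ℤ := B y₁ a with hα
  set β : ℤ := B x₁ a with hβ
  set w : W := a - α • x₁ - β • y₁ with hw
  have hyw : B y w = 0 := by rw [hw, map_sub, map_sub, map_smul, map_smul, hya, h.yx₁, h.yy₁]; simp
  have hx₁w : B x₁ w = 0 := by
    rw [hw, map_sub, map_sub, map_smul, map_smul, ← hβ, h.x₁x₁, h.x₁y₁]; simp
  have hy₁w : B y₁ w = 0 := by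
    rw [hw, map_sub, map_sub, map_smul, map_smul, ← hα, h.y₁y₁, h.y₁x₁]; simp
  have hww : B w w = (q - α * β) + (q - α * β) := by
    have hax₁ : B a x₁ = β := by rw [hB.eq, hβ]
    have hay₁ : B a y₁ = α := by rw [hB.eq, hα]
    simp only [hw, map_sub, map_smul, LinearMap.sub_apply, LinearMap.smul_apply, smul_eq_mul, hq, hax₁, hay₁, ← hα, ← hβ,
      h.x₁x₁, h.x₁y₁, h.y₁x₁, h.y₁y₁]
    ring
  have hyα : B y (α • x₁) = 0 := by rw [map_smul, h.yx₁, smul_zero]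
  have hαα : B (α • x₁) (α • x₁) = 0 + 0 := by simp [h.x₁x₁]
  have hyβ : B y (β • y₁) = 0 := by rw [map_smul, h.yy₁, smul_zero]
  have hββ : B (β • y₁) (β • y₁) = 0 + 0 := by simp [h.y₁y₁]
  have hF₁ := isWordIn_reflections_eichlerTransvection_y_smul_x₁ h hε hyr hx₁r hrr α hyα hαα
  have hF₂ : IsWordIn {ψ : B.IsometryEquiv B | ∃ (r : W) (hr : B r r = ε + ε), ψ = normTwoReflectionEquiv hB r ε hr hε}
      (LinearMap.BilinForm.IsometryEquiv.eichlerTransvection B hB y (β • y₁) 0 h.yy hyβ hββ) :=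
    isWordIn_reflections_eichlerTransvection_y_smul_x₁ h.symm_right hε hyr hy₁r hrr β hyβ hββ
  have hF₃ := isWordIn_reflections_eichlerTransvection_y_of_ortho h hε hyr hx₁r hy₁r hrr hyw hx₁w hy₁w hww
  have comp : B.eichlerTransvection y (α • x₁) 0 ∘ₗ (B.eichlerTransvection y (β • y₁) 0 ∘ₗ
      B.eichlerTransvection y w (q - α * β)) = B.eichlerTransvection y a q := by
    rw [LinearMap.BilinForm.eichlerTransvection_comp B hB h.yy hyβ hyw,
      LinearMap.BilinForm.eichlerTransvection_comp B hB h.yy hyα (by rw [map_add, hyβ, hyw, add_zero])]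
    have hv : α • x₁ + (β • y₁ + w) = a := by rw [hw]; module
    have hp : (0 : ℤ) + (0 + (q - α * β) + B (β • y₁) w) + B (α • x₁) (β • y₁ + w) = q := by
      simp only [map_add, map_smul, LinearMap.smul_apply, smul_eq_mul, hy₁w, hx₁w, h.x₁y₁]
      ring
    rw [hv, hp]
  refine ((hF₃.trans hF₂).trans hF₁).congr fun v ↦ ?_
  rw [LinearMap.BilinForm.IsometryEquiv.trans_apply, LinearMap.BilinForm.IsometryEquiv.trans_apply,
    LinearMap.BilinForm.IsometryEquiv.eichlerTransvection_apply, LinearMap.BilinForm.IsometryEquiv.eichlerTransvection_apply,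
    LinearMap.BilinForm.IsometryEquiv.eichlerTransvection_apply, UGen.toIsometryEquiv_apply]
  change _ = B.eichlerTransvection y a q v
  rw [← comp, LinearMap.comp_apply, LinearMap.comp_apply]

/-- **Every admissible letter (`E(y,a,q)` or `E(x,a,q)`) is a word in `(2ε)`-reflections.** [cite: GritsenkoHulekSankaran2009, §3.1 (t6) and §3.3 (16)] -/
theorem isWordIn_reflections_toIsometryEquiv (h : TwoHyperbolicPairs B x y x₁ y₁) (hε : ε * ε = 1) (hxr : B x r = 0)
    (hyr : B y r = 0) (hx₁r : B x₁ r = 0) (hy₁r : B y₁ r = 0) (hrr : B r r = ε + ε) (g : UGen W)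
    (hg : g.IsAdmissible B x y) :
    IsWordIn {ψ : B.IsometryEquiv B | ∃ (r : W) (hr : B r r = ε + ε), ψ = normTwoReflectionEquiv h.isSymm r ε hr hε}
      (UGen.toIsometryEquiv h.isSymm h.xx h.yy g hg) := by
  cases g with
  | atY a q => exact isWordIn_reflections_toIsometryEquiv_atY h hε hyr hx₁r hy₁r hrr a q hg
  | atX a q =>
    have hg' : (UGen.atY a q).IsAdmissible B y x := ⟨hg.2.1, hg.1, hg.2.2⟩
    refine (isWordIn_reflections_toIsometryEquiv_atY h.symm_left hε hxr hx₁r hy₁r hrr a q hg').congr fun v ↦ ?_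
    rw [UGen.toIsometryEquiv_apply, UGen.toIsometryEquiv_apply]
    rfl

/-- **`E_U(L₁) ⊆ ⟨σ_r : r² = 2ε⟩`**: in a symmetric even `(W,B)` with two orthogonal hyperbolic pairs and a vector
`r ⊥ U ⊕ U₁` of norm `2ε = ±2`, every admissible word is a word in the reflections in `(2ε)`-vectors — the inclusion
`E(L) ⊆ ⟨σ_a σ_b⟩` of (16) "`S̃O⁺(L) = O'(L) = E(L)`" (each transvection being a product of pairs of such reflections).
[cite: GritsenkoHulekSankaran2009, §3.1 (t6), §3.3 (16) and Thm. 1.1] -/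
theorem isWordIn_reflections_evalEquiv (h : TwoHyperbolicPairs B x y x₁ y₁) (hε : ε * ε = 1) (hxr : B x r = 0)
    (hyr : B y r = 0) (hx₁r : B x₁ r = 0) (hy₁r : B y₁ r = 0) (hrr : B r r = ε + ε) (l : List (UGen W))
    (hl : ∀ g ∈ l, g.IsAdmissible B x y) :
    IsWordIn {ψ : B.IsometryEquiv B | ∃ (r : W) (hr : B r r = ε + ε), ψ = normTwoReflectionEquiv h.isSymm r ε hr hε}
      (UGen.evalEquiv h.isSymm h.xx h.yy l hl) := by
  induction l with
  | nil => exact IsWordIn.refl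
  | cons g l ih =>
    exact (ih fun g' hg' ↦ hl g' (List.mem_cons_of_mem g hg')).trans
      (isWordIn_reflections_toIsometryEquiv h hε hxr hyr hx₁r hy₁r hrr g (hl g List.mem_cons_self))

end Words

/-! ### §3 `L = 3U`: `O⁺(3U)` is generated by the `(−2)`-reflections -/

section ThreeU

/-- The vector `x₂ + ε y₂` of the innermost plane of `(H ⊕ H) ⊕ H`: norm `2ε`, orthogonal to the outer and middle
planes. [cite: GritsenkoHulekSankaran2009, §3.3 Prop. 3.3 (iv) (σ_{e−f})] -/
theorem threeU_inner_add_smul (ε : ℤ) :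
    ((hyperbolicForm.prod hyperbolicForm).prod hyperbolicForm)
        (((((Pi.single 0 1 : Fin 2 → ℤ), (0 : Fin 2 → ℤ)) : (Fin 2 → ℤ) × (Fin 2 → ℤ)), (0 : Fin 2 → ℤ)) +
          ε • ((((Pi.single 1 1 : Fin 2 → ℤ), (0 : Fin 2 → ℤ)) : (Fin 2 → ℤ) × (Fin 2 → ℤ)), (0 : Fin 2 → ℤ)))
        (((((Pi.single 0 1 : Fin 2 → ℤ), (0 : Fin 2 → ℤ)) : (Fin 2 → ℤ) × (Fin 2 → ℤ)), (0 : Fin 2 → ℤ)) +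
          ε • ((((Pi.single 1 1 : Fin 2 → ℤ), (0 : Fin 2 → ℤ)) : (Fin 2 → ℤ) × (Fin 2 → ℤ)), (0 : Fin 2 → ℤ))) =
      ε + ε :=
  apply_add_smul_self twoHyperbolicPairs_threeU_middle_inner.swap.isSymm twoHyperbolicPairs_threeU_outer_inner.x₁x₁
    twoHyperbolicPairs_threeU_outer_inner.y₁y₁ twoHyperbolicPairs_threeU_outer_inner.x₁y₁ ε

/-- **`SO⁺(3U) ⊆ ⟨σ_r : r² = 2ε⟩`** for either sign: every `φ ∈ SO⁺(U ⊕ U ⊕ U)` is a word in the reflections in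
`(2ε)`-vectors (`SO⁺(3U) = E(3U)` by g49-#7, and §2 with `r = e₂ + εf₂`). [cite: GritsenkoHulekSankaran2009, Thm. 1.1 and §3.3 (16)] -/
theorem isWordIn_reflections_of_isOrientationPreserving_of_det_eq_one_threeU {ε : ℤ} (hε : ε * ε = 1)
    (φ : ((hyperbolicForm.prod hyperbolicForm).prod hyperbolicForm).IsometryEquiv
      ((hyperbolicForm.prod hyperbolicForm).prod hyperbolicForm))
    (h₁ : φ.IsOrientationPreserving)
    (h₂ : LinearMap.det (φ : ((Fin 2 → ℤ) × (Fin 2 → ℤ)) × (Fin 2 → ℤ) →ₗ[ℤ]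
      ((Fin 2 → ℤ) × (Fin 2 → ℤ)) × (Fin 2 → ℤ)) = 1) :
    IsWordIn {ψ | ∃ (r : ((Fin 2 → ℤ) × (Fin 2 → ℤ)) × (Fin 2 → ℤ))
        (hr : ((hyperbolicForm.prod hyperbolicForm).prod hyperbolicForm) r r = ε + ε),
        ψ = normTwoReflectionEquiv ((isSymm_hyperbolicForm.prod isSymm_hyperbolicForm).prod isSymm_hyperbolicForm) r ε hr hε}
      φ := by
  obtain ⟨L, hL, rfl⟩ := (isOrientationPreserving_and_det_eq_one_iff_exists_uGens_threeU φ).1 ⟨h₁, h₂⟩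
  have P₁ := twoHyperbolicPairs_prod_prod_hyperbolic (Q := hyperbolicForm) isSymm_hyperbolicForm
  have P₂ := twoHyperbolicPairs_threeU_outer_inner
  have P₁₂ := twoHyperbolicPairs_threeU_middle_inner
  exact isWordIn_reflections_evalEquiv P₁ hε
    (by rw [map_add, map_smul, P₂.xx₁, P₂.xy₁, smul_zero, add_zero])
    (by rw [map_add, map_smul, P₂.yx₁, P₂.yy₁, smul_zero, add_zero])
    (by rw [map_add, map_smul, P₁₂.xx₁, P₁₂.xy₁, smul_zero, add_zero])
    (by rw [map_add, map_smul, P₁₂.yx₁, P₁₂.yy₁, smul_zero, add_zero]) (threeU_inner_add_smul ε) L hL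

/-- **`O⁺(3U) = ⟨σ_r : r² = −2⟩`** (Kneser's Theorem 1.1 / "`Õ⁺(L) = ⟨S̃O⁺(L), σ_{e−f}⟩`" for `L = U ⊕ U ⊕ U`): an isometry of
`(H ⊕ H) ⊕ H` is a word in the `(−2)`-reflections iff it preserves the orientation of the positive directions — "⟸":
`O⁺ = SO⁺ ∪ SO⁺·σ_{e−f}` (`det = ±1`, `σ_{e−f} ∈ O⁺` has `det = −1`) and `SO⁺(3U) ⊆ ⟨σ_r⟩`; "⟹": `(−2)`-reflections lie in
`O⁺`. [cite: GritsenkoHulekSankaran2009, Thm. 1.1, §1 ("The reflection … σ_a … belongs to Õ⁺(L)") and §4 ("Õ⁺(L) = ⟨S̃O⁺(L), σ_{e−f}⟩")] -/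
theorem isWordIn_negTwoReflections_iff_isOrientationPreserving_threeU
    (φ : ((hyperbolicForm.prod hyperbolicForm).prod hyperbolicForm).IsometryEquiv
      ((hyperbolicForm.prod hyperbolicForm).prod hyperbolicForm)) :
    IsWordIn {ψ | ∃ (r : ((Fin 2 → ℤ) × (Fin 2 → ℤ)) × (Fin 2 → ℤ))
        (hr : ((hyperbolicForm.prod hyperbolicForm).prod hyperbolicForm) r r = -1 + -1),
        ψ = normTwoReflectionEquiv ((isSymm_hyperbolicForm.prod isSymm_hyperbolicForm).prod isSymm_hyperbolicForm) r (-1) hr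
          (by norm_num)} φ ↔
      φ.IsOrientationPreserving := by
  have hB : ((hyperbolicForm.prod hyperbolicForm).prod hyperbolicForm).IsSymm :=
    (isSymm_hyperbolicForm.prod isSymm_hyperbolicForm).prod isSymm_hyperbolicForm
  have hnd := nondegenerate_threeU
  refine ⟨fun hφ ↦ (IsWordIn.isOrientationPreserving_and_congr_eq_refl_of_negTwoReflections _ hB hnd
    (fun s hs ↦ hs) hφ).1, fun h₁ ↦ ?_⟩
  rcases LinearMap.BilinForm.IsometryEquiv.det_eq_one_or_eq_neg_one φ with hdet | hdet
  · exact isWordIn_reflections_of_isOrientationPreserving_of_det_eq_one_threeU (by norm_num) φ h₁ hdet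
  · -- `φ = (φ σ) σ` with `σ = σ_{x−y}` the `(−2)`-reflection in `x − y` of the outer plane, `φσ ∈ SO⁺`
    have P₁ := twoHyperbolicPairs_prod_prod_hyperbolic (Q := hyperbolicForm) isSymm_hyperbolicForm
    have hw := apply_add_smul_self hB P₁.xx P₁.yy P₁.xy (-1)
    set σ := normTwoReflectionEquiv hB (hypX + (-1 : ℤ) • hypY) (-1) hw (by norm_num) with hσ
    have hσO : σ.IsOrientationPreserving :=
      (isOrientationPreserving_normTwoReflectionEquiv_iff _ hB hnd _ (-1) hw (by norm_num)).2 rfl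
    have hσdet := det_normTwoReflectionEquiv _ hB (hypX + (-1 : ℤ) • hypY) (-1) hw (by norm_num)
    have hφσ : IsWordIn {ψ | ∃ (r : ((Fin 2 → ℤ) × (Fin 2 → ℤ)) × (Fin 2 → ℤ))
        (hr : ((hyperbolicForm.prod hyperbolicForm).prod hyperbolicForm) r r = -1 + -1),
        ψ = normTwoReflectionEquiv hB r (-1) hr (by norm_num)} (φ.trans σ) := by
      refine isWordIn_reflections_of_isOrientationPreserving_of_det_eq_one_threeU (by norm_num) _ ?_ ?_
      · rw [LinearMap.BilinForm.IsometryEquiv.isOrientationPreserving_trans_iff hB hnd]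
        exact iff_of_true hσO h₁
      · rw [show ((φ.trans σ : ((hyperbolicForm.prod hyperbolicForm).prod hyperbolicForm).IsometryEquiv _) :
            ((Fin 2 → ℤ) × (Fin 2 → ℤ)) × (Fin 2 → ℤ) →ₗ[ℤ] ((Fin 2 → ℤ) × (Fin 2 → ℤ)) × (Fin 2 → ℤ)) =
            (σ : ((Fin 2 → ℤ) × (Fin 2 → ℤ)) × (Fin 2 → ℤ) →ₗ[ℤ] ((Fin 2 → ℤ) × (Fin 2 → ℤ)) × (Fin 2 → ℤ)) ∘ₗ
            (φ : ((Fin 2 → ℤ) × (Fin 2 → ℤ)) × (Fin 2 → ℤ) →ₗ[ℤ] ((Fin 2 → ℤ) × (Fin 2 → ℤ)) × (Fin 2 → ℤ)) from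
          LinearMap.ext fun _ ↦ rfl, LinearMap.det_comp, hσdet, hdet]
        norm_num
    refine (hφσ.trans (IsWordIn.of_mem ⟨hypX + (-1 : ℤ) • hypY, hw, rfl⟩)).congr fun v ↦ ?_
    rw [LinearMap.BilinForm.IsometryEquiv.trans_apply, LinearMap.BilinForm.IsometryEquiv.trans_apply, ← hσ,
      normTwoReflectionEquiv_apply, normTwoReflectionEquiv_apply, ← LinearMap.BilinForm.normTwoReflection_apply,
      ← LinearMap.BilinForm.normTwoReflection_apply,
      normTwoReflection_add_smul_normTwoReflection_add_smul hB P₁.xx P₁.yy P₁.xy (by norm_num)]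

end ThreeU

end Literature.Topology.FourManifolds

end
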